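/- Copyright: the b2b-balaban cell (near-miss cell 7), T⁴-continuum fan-out; row NE7b ROUND-2 swarm, seat
t4-ne7b-formalise-leaf-03 (gen 4) (road W-RP, row W6 «W-ROAD APEX ∕ HEADLINE» of `t4/b2b-balaban-t4-ne7b-p1/LEAVES-NE7b.md`
v3.50, owner's NEW ROW journal l.16605, CLAIM l.16612; file 2 of 3).  Released under the licence of the surrounding project. -/
import Summits.QuantumFields.BalabanUV.T4Continuum.Support.HistoryChessboardEventsCutoff
import Summits.QuantumFields.BalabanUV.T4Continuum.Support.HistoryRealiseCellsRunApexT3b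

/-!
# Road W-RP, row W6 file 2: THE W-ROAD AT THE APEX — a chessboard-road witness per (tuned run, loop string) ⇒ `HybridNE7Under`

Summits-side support leaf of the T⁴-continuum cell (rung (B)+1 on a FINITE torus only; NOT infinite volume, NOT the
mass gap, NOT the Clay statement; NOT a proof of the spine estimate NE7b).  Row NE7b, road **W-RP** (owner's rulings
R-OWNER-23-2 ∕ R-OWNER-23-8: a LIVE SECONDARY road beside the COUNT road of record — the PRINTED 4-d averaging prescription
[B12] (0.3)–(0.4), centred and lattice-Euclidean symmetrised by construction), row **W6** (the mirror of the count road's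
S12g ∕ S12i for the W road).  [folklore] composition BY NAME of the W-road END of the per-cutoff event reading
(`HistoryChessboardEventsCutoff.hybridNE7_of_cutoffReadings`, leaf-06 gen 4, p220032 — over `HistoryChessboardAssembly`'s
`hybridNE7_of_chessboard`, p218970) with the count road's STRUCTURE-FREE one-string step
`HistoryRealiseCellsRunApexT3b.stringHybridNE7_of_hybridNE7_repr` (leaf-02 gen 9, p223239: `HybridNE7` for the shifted
families in Bałaban's normalisation + the E1∕E2 representation identities ⇒ the apex lineage's per-string datum
`T4MatchingAssembly.StringHybridNE7 (D.scheme g₀) os …`, rescaling by `HistoryHybridRescale.hybridNE7_smul`).  Nothing is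
quoted from Bałaban's papers, nothing printed is asserted, no `[cite:]` tag, no `Prop`-valued FACT minted (trigger c1):
the one `structure` below (`ChessboardRoadWitness`, in `Type`, types as PARAMETERS, no instance attributes) is a
HYPOTHESIS SHAPE — data + the END's displayed binders — consumed only under `Nonempty` inside a binder (definition lane).

WHAT.  §1 **`ChessboardRoadWitness D g₀ os ι Λ Ω Ω' d N`**: for the tuned run `g₀` and the loop string `os` — a source
radius `l₀ > 0`, a volume factor `vol > 0`, a threshold `K₀`; the block torus `BlockIdx d N` (`N` cells per direction,
`Even N` a field) and the finite pattern family `P : Finset Λ` (the shifted tilings); the two runs' term families `T K`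
with dressed weights `A` (run A, `K` steps), `A'` (run B, `K + 1` steps), bad classes `Bad K`, shell parts `shA shB`;
per cutoff `K ≥ K₀` and per run, ON THE CUTOFF'S OWN CARRIER `Ω K` ∕ `Ω' K`, the W-road's per-cutoff event reading
`HistoryChessboardEventsCutoff.CutoffReading` VERBATIM (fields `readingA`, `readingB` — the END's hypotheses `HA`, `HB`):
a probability state `μ K`, partition function `Z K`, term events, a bounded source observable, cell events of the patterns,
block reflections + positive-half σ-algebras with the RP-package, (LOC), (R-sym), (U1)+(G2) in ratio currency, the
per-cell rates `r`, `r'` (summable); NE7c's `ShellWeightBound`; NE7's `ReindexedBudget` on the hybrid cores with its rates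
(`rr u s s₂` summable); and the E1∕E2 REPRESENTATION identities `reprA`∕`reprB` tying the term sums to the run's dressed
integrals `∫ e^{t·prodObs_K} ρ₀ dU` in Bałaban's normalisation (`ρ₀ = D.dens K (g₀ K) 0`) — exactly as in the count road's
`CountRoadWitnessT3b`.  §2 **`stringHybridNE7_of_chessboardRoad`** (one witness ⇒ `StringHybridNE7 (D.scheme g₀) os l₀ vol
(K₁ + K₂)` for the END's thresholds) and **`stringwise_of_chessboardRoad`**.  §3 the apex input:
**`forSmallCouplings_stringwise_of_chessboardRoad (hData : ForSmallCouplings D fun g₀ => ∀ os, ∃ …, Nonempty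
(ChessboardRoadWitness D g₀ os …)) : ForSmallCouplings D fun g₀ => StringwiseHybridNE7 (D.scheme g₀)`** — PIN-FREE: the
W-road END consumes NEITHER `(B) = B16.EndStatementBPrinted D.C` NOR `BetaPertHyp D.βfun` (file 1 `HistoryChessboardPinned`
says so in the kernel: thresholds `γ₁ = g₁ = 1`) — whence **`hybridNE7Under_of_chessboardRoad_fsc : T4ApexHybrid.HybridNE7Under
D (BetaPertHyp D.βfun)`** (the apex lineage's input for ALL FOUR T⁴ targets; its two antecedents are accepted and not
used) and the every-`γ, g > 0` form `hybridNE7Under_of_chessboardRoad`.  File 3 (`HistoryChessboardHeadline`) draws the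
targets and `ContinuumYM4Torus D`, where the pins enter — at `T4ContinuumYM4Torus.continuumYM4Torus_of_targets` only.

WHAT THE WITNESS DISPLAYS (nothing of it is discharged here; this list IS the W road's column of the Edisonian census,
to be compared field by field with the count road's `CountRoadWitnessT3b`): per run and cutoff the 21 clauses of
`CutoffReading` — (EXT)+(DRESS) `repr`, `ev_cover`, `bad_disj`, (EXT)∘(LOC) `bad_sub`, the RP-package `mP_le θ_meas θ_pres
θ_invol rp` = (RP-ext) (for the Gibbs towers of the printed (0.4) average these five + `prob` + `Even N` are PRODUCED BY
NAME by rows W3f–W3m ∕ W4c — `HistoryRPTowerCuts.cutoffRP_towerLaw_gibbs_SU`, `HistoryChessboardEventsSplit` — modulo the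
typing identification «`avgFun ℰ` = (0.4)» and the identification of the run's state at cutoff `K` with that tower law,
which stay READINGS), (LOC) `loc`, (R-sym) `sym`, (U1)+(G2) `univ_le` (a (0.1)-upper-half-KIND numerator against (B)'s
global lower bound, in ratio currency — (B)'s CONTENT enters here as a reading, not the pin by name); the E1∕E2 identities;
NE7c's `ShellWeightBound`; NE7's `ReindexedBudget` (carrying node U4′'s sizes and the recent-scale rates, hence the content
of NE1′–NE5, NE9); summable rates.  Against the count road: NO H3 (no pedigrees, no price sentence (E2)∕(R1), no
`Regeneration` numerator readings), NO constants-side prefix, NO coupling window used.  HONEST SCOPE (R-OWNER-23-8): a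
producer for the printed, centred 4-d prescription; (RP-ext) displayed as the covariance reading (γ); nothing of the nine
discharged; the count 0∕9 is unchanged.  NE7b NOT proved; spine 0∕9.  HONEST DEPENDENCY (cell): continuum YM on T⁴ ⇐
BetaPertH ∧ nine spine estimates (0/9 proved); BetaPertH ⇐ (D1) ∧ (D4) ∧ CAP+tail; G-an2-4 gates asym, D1 and NE2/3/4.
This file changes none of it. -/

open Finset MeasureTheory
open Literature.MathematicalPhysics.QuantumFieldTheory.Balaban1983to89
open Literature.MathematicalPhysics.QuantumFieldTheory.Balaban1983to89.T4WeightBudget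
open Literature.MathematicalPhysics.QuantumFieldTheory.Balaban1983to89.T4IndicatorShell
open Literature.MathematicalPhysics.QuantumFieldTheory.Balaban1983to89.T4MatchingAssembly
open Literature.MathematicalPhysics.QuantumFieldTheory.Balaban1983to89.T4MatchingClosure
open Literature.Barriers.CriticalPhenomena.NonGibbs Literature.Probability.LatticeModels
open T4Continuum T4StabilitySocket
open Summit.QuantumFields.BalabanUV.T4Continuum.HistoryChessboardEventsCutoff
open Summit.QuantumFields.BalabanUV.T4Continuum.HistoryRealiseCellsRunApexT3b (stringHybridNE7_of_hybridNE7_repr)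

namespace Summit.QuantumFields.BalabanUV.T4Continuum.HistoryChessboardApex

noncomputable section

/-! ## §1 The chessboard-road witness of ONE tuned run and ONE loop string -/

section Witness

variable {F : T4Family} {G : Type*} [GaugeGroup G] [MeasurableSpace G] [HaarData G]

/-- **A CHESSBOARD-ROAD WITNESS for the tuned run `g₀` and the loop string `os`** (HYPOTHESIS SHAPE — data + the W-road
END's displayed binders, NOTHING asserted): the term families of the string's two dressed partition functions (run A after
`K` steps, run B after `K + 1` steps, from `K₀` on, in BAŁABAN's normalisation) with the E1∕E2 representation identities;
per cutoff and run, on the cutoff's own carrier, the per-cutoff event reading `CutoffReading` of road W-RP VERBATIM (the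
hypotheses `HA`∕`HB` of `HistoryChessboardEventsCutoff.hybridNE7_of_cutoffReadings`); summable per-cell rates; NE7c's
`ShellWeightBound`; NE7's `ReindexedBudget` with four summable rates; a positive source radius and volume factor; `Even N`.
The term index type `ι`, the pattern type `Λ`, the carriers `Ω K`∕`Ω' K` (with their measurable structures) and the block
counts `d N` (`NeZero N`) are PARAMETERS.  Field names follow the END's binders (`HA ↦ readingA`, `HB ↦ readingB`, rate
letters `ν u s₂ c₀ rr s` as in the END) and the count road's `CountRoadWitnessT3b` (`reprA`, `reprB`, `shell`, `budget`,
`sum_*`). [folklore] -/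
structure ChessboardRoadWitness (D : FiniteEpsData F G) (g₀ : ℕ → ℝ) (os : List (ULoop F)) (ι Λ : Type) [DecidableEq ι]
    (Ω Ω' : ℕ → Type) [∀ K, MeasurableSpace (Ω K)] [∀ K, MeasurableSpace (Ω' K)] (d N : ℕ) [NeZero N] : Type where
  /-- the source radius -/
  l₀ : ℝ
  /-- the volume factor of the matching remainders -/
  vol : ℝ
  /-- the source radius is positive -/
  l₀_pos : 0 < l₀
  /-- the volume factor is positive -/
  vol_pos : 0 < vol
  /-- the threshold in the number of steps -/
  K₀ : ℕ
  /-- the block torus has an even number of cells per direction (the printed (0.1) format) -/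
  even : Even N
  /-- the finite family of patterns (the shifted tilings) -/
  P : Finset Λ
  /-- the term families -/
  T : ℕ → Finset ι
  /-- run A's term weights (`K` steps) -/
  A : ℕ → ℝ → ι → ℝ
  /-- run B's term weights (`K + 1` steps) -/
  A' : ℕ → ℝ → ι → ℝ
  /-- the two runs' shell parts (NE7c) -/
  (shA shB : ℕ → ℝ → ι → ℝ)
  /-- the bad classes (terms carrying old pending structure; constant in the source) -/
  Bad : ℕ → Finset ι
  /-- run A: the normalised extended state at each cutoff, on the cutoff's carrier -/
  μ : ∀ K, Measure (Ω K)
  /-- run A: undressed partition functions -/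
  Z : ℕ → ℝ
  /-- run A: term events -/
  ev : ∀ K, ι → Set (Ω K)
  /-- run A: the source observable read on the carrier -/
  obs : ∀ K, Ω K → ℝ
  /-- the common bound of the source observables -/
  ob : ℝ
  /-- run A: the cell events of the patterns -/
  E : ∀ K, Λ → BlockIdx d N → Set (Ω K)
  /-- run A: the block reflections -/
  θ : ∀ K, Fin d → ZMod N → Ω K → Ω K
  /-- run A: the positive-half σ-algebras -/
  mP : ∀ K, Fin d → ZMod N → MeasurableSpace (Ω K)
  /-- run A: per-cell rates -/
  r : ℕ → ℝ
  /-- run B: the normalised extended state at each cutoff, on the cutoff's carrier -/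
  μ' : ∀ K, Measure (Ω' K)
  /-- run B: undressed partition functions -/
  Z' : ℕ → ℝ
  /-- run B: term events -/
  ev' : ∀ K, ι → Set (Ω' K)
  /-- run B: the source observable read on the carrier -/
  obs' : ∀ K, Ω' K → ℝ
  /-- run B: the cell events of the patterns -/
  E' : ∀ K, Λ → BlockIdx d N → Set (Ω' K)
  /-- run B: the block reflections -/
  θ' : ∀ K, Fin d → ZMod N → Ω' K → Ω' K
  /-- run B: the positive-half σ-algebras -/
  mP' : ∀ K, Fin d → ZMod N → MeasurableSpace (Ω' K)
  /-- run B: per-cell rates -/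
  r' : ℕ → ℝ
  /-- W-RP: run A's per-cutoff event reading from the threshold on (the END's `HA`, VERBATIM) -/
  readingA : ∀ K, K₀ ≤ K →
    CutoffReading d N P (T K) (A K) (Bad K) (μ K) (Z K) (ev K) (obs K) ob (E K) (θ K) (mP K) (r K)
  /-- W-RP: run B's per-cutoff event reading from the threshold on (the END's `HB`, VERBATIM) -/
  readingB : ∀ K, K₀ ≤ K →
    CutoffReading d N P (T K) (A' K) (Bad K) (μ' K) (Z' K) (ev' K) (obs' K) ob (E' K) (θ' K) (mP' K) (r' K)
  /-- run A's per-cell rates are summable over the cutoff -/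
  sum_r : Summable r
  /-- run B's per-cell rates are summable over the cutoff -/
  sum_r' : Summable r'
  /-- NE7 core budget data (`ReindexedBudget`) -/
  (Cc Rr CcRec RrRec : ℕ → ℝ → ι → ℝ)
  /-- NE7 core budget rates (the END's letters); `rr u s s₂` summable -/
  (ν u s₂ c₀ rr s : ℕ → ℝ)
  /-- NE7c's shell weight budget -/
  Wsh : ℕ → ℝ
  /-- NE7c: the indicator shells' relative weight bound -/
  shell : ShellWeightBound l₀ T A A' shA shB Wsh
  /-- NE7: the core budget on the hybrid cores over the bad classes -/
  budget : ReindexedBudget l₀ vol T (fun K t τ => A K t τ - shA K t τ) (fun K t τ => A' K t τ - shB K t τ)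
    (fun K _ => Bad K) Cc Rr CcRec RrRec ν u s₂ c₀ rr s
  /-- summable rates -/
  sum_rr : Summable rr
  /-- summable rates -/
  sum_u : Summable u
  /-- summable rates -/
  sum_s : Summable s
  /-- summable rates -/
  sum_s₂ : Summable s₂
  /-- E1 REPRESENTATION (Bałaban's normalisation): run A's terms sum to the dressed integral of `ρ₀` after `K` steps -/
  reprA : ∀ K t, |t| ≤ l₀ → K₀ ≤ K →
    ∫ U, Real.exp (t * T4GenFunBounds.prodObs (D.scheme g₀) K os U) * D.dens K (g₀ K) 0 U ∂fieldMeasure (F.P K) 0 G =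
      ∑ τ ∈ T K, A K t τ
  /-- E2 REPRESENTATION: run B's terms sum to the dressed integral of `ρ₀` after `K + 1` steps -/
  reprB : ∀ K t, |t| ≤ l₀ → K₀ ≤ K →
    ∫ U, Real.exp (t * T4GenFunBounds.prodObs (D.scheme g₀) (K + 1) os U) * D.dens (K + 1) (g₀ (K + 1)) 0 U
        ∂fieldMeasure (F.P (K + 1)) 0 G = ∑ τ ∈ T K, A' K t τ

end Witness

/-! ## §2 One witness ⇒ the apex lineage's per-string datum -/

section String

variable {F : T4Family} {G : Type*} [GaugeGroup G] [MeasurableSpace G] [HaarData G]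
  {D : FiniteEpsData F G} {g₀ : ℕ → ℝ} {os : List (ULoop F)} {ι Λ : Type} [DecidableEq ι] {Ω Ω' : ℕ → Type}
  [∀ K, MeasurableSpace (Ω K)] [∀ K, MeasurableSpace (Ω' K)] {d N : ℕ} [NeZero N]

/-- **THE W-ROAD END READ OFF A WITNESS**: `HybridNE7` for the families shifted by `K₁ + K₂`, some `K₁ ≥ K₀`, with the
weight `e^{2·ob·l₀}·#P·N^d·(r + r′)` — `HistoryChessboardEventsCutoff.hybridNE7_of_cutoffReadings` BY NAME on the fields.
[folklore] -/
theorem ChessboardRoadWitness.hybridNE7 (X : ChessboardRoadWitness D g₀ os ι Λ Ω Ω' d N) :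
    ∃ K₁ K₂, X.K₀ ≤ K₁ ∧ HybridNE7 X.l₀ X.vol (fun K => X.T (K₁ + (K₂ + K))) (fun K => X.A (K₁ + (K₂ + K)))
      (fun K => X.A' (K₁ + (K₂ + K))) (fun K _ => X.Bad (K₁ + (K₂ + K)))
      (fun K => Real.exp (2 * (X.ob * X.l₀)) *
        ((#X.P : ℝ) * (N : ℝ) ^ d * (X.r (K₁ + (K₂ + K)) + X.r' (K₁ + (K₂ + K)))))
      (fun K => X.shA (K₁ + (K₂ + K))) (fun K => X.shB (K₁ + (K₂ + K))) (fun K => X.Wsh (K₁ + (K₂ + K)))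
      (fun K => (X.rr (K₁ + (K₂ + K)) + X.u (K₁ + (K₂ + K))) + (X.s (K₁ + (K₂ + K)) + X.s₂ (K₁ + (K₂ + K)))) :=
  hybridNE7_of_cutoffReadings X.even X.readingA X.readingB X.sum_r X.sum_r' X.shell X.budget X.sum_rr X.sum_u X.sum_s
    X.sum_s₂

/-- **ONE STRING: A CHESSBOARD-ROAD WITNESS ⇒ THE APEX'S PER-STRING HYBRID-NE7 DATUM** `StringHybridNE7 (D.scheme g₀) os l₀
vol (K₁ + K₂)` — the END on the fields, then the count road's structure-free step `stringHybridNE7_of_hybridNE7_repr`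
(p223239) with the witness' E1∕E2 identities (rescaling of each run by the constant of `exists_const_schemeZ`). [folklore] -/
theorem stringHybridNE7_of_chessboardRoad (X : ChessboardRoadWitness D g₀ os ι Λ Ω Ω' d N) :
    ∃ K, X.K₀ ≤ K ∧ StringHybridNE7 (D.scheme g₀) os X.l₀ X.vol K := by
  obtain ⟨K₁, K₂, hK₁, hH⟩ := X.hybridNE7
  exact ⟨K₁ + K₂, hK₁.trans (Nat.le_add_right _ _), stringHybridNE7_of_hybridNE7_repr D X.reprA X.reprB hK₁ hH⟩

/-- **ONE TUNED RUN: a witness for EVERY loop string ⇒ `StringwiseHybridNE7 (D.scheme g₀)`** (node U5's per-string output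
shape of the apex lineage, `T4ApexHybrid`). [folklore] -/
theorem stringwise_of_chessboardRoad
    (h : ∀ os : List (ULoop F), ∃ (ι Λ : Type) (_ : DecidableEq ι) (Ω Ω' : ℕ → Type) (_ : ∀ K, MeasurableSpace (Ω K))
      (_ : ∀ K, MeasurableSpace (Ω' K)) (d N : ℕ) (_ : NeZero N), Nonempty (ChessboardRoadWitness D g₀ os ι Λ Ω Ω' d N)) :
    T4ApexHybrid.StringwiseHybridNE7 (D.scheme g₀) := fun os => by
  obtain ⟨ι, Λ, _, Ω, Ω', _, _, d, N, _, ⟨X⟩⟩ := h os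
  obtain ⟨K, -, hK⟩ := stringHybridNE7_of_chessboardRoad X
  exact ⟨X.l₀, X.vol, K, X.l₀_pos, X.vol_pos, hK⟩

end String

/-! ## §3 Under the prefix: the apex input, PIN-FREE, and `HybridNE7Under` -/

section Under

variable {F : T4Family} {G : Type*} [GaugeGroup G] [MeasurableSpace G] [HaarData G]

/-- **ROW NE7b, ROAD W-RP, AT THE APEX — PIN-FREE FORM.**  If for all SMALL-coupling tuned runs `g₀` and every loop string
`os` a `ChessboardRoadWitness` is displayed (`T4ContinuumYM4Torus.ForSmallCouplings`), then for the same runs every string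
carries the apex lineage's hybrid-NE7 datum.  NEITHER `(B)` NOR `BetaPertHyp` is an input: the W-road END consumes no pin
and no coupling window (file 1 `HistoryChessboardPinned`: thresholds `γ₁ = g₁ = 1`); the prefix is inherited from the
hypothesis unchanged (`T4ContinuumYM4Torus.ForSmallCouplings.mono` BY NAME). CONDITIONAL on the displayed witnesses;
NE7b NOT proved. [folklore] -/
theorem forSmallCouplings_stringwise_of_chessboardRoad (D : FiniteEpsData F G)
    (hData : T4ContinuumYM4Torus.ForSmallCouplings D fun g₀ => ∀ os : List (ULoop F),
      ∃ (ι Λ : Type) (_ : DecidableEq ι) (Ω Ω' : ℕ → Type) (_ : ∀ K, MeasurableSpace (Ω K))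
        (_ : ∀ K, MeasurableSpace (Ω' K)) (d N : ℕ) (_ : NeZero N),
        Nonempty (ChessboardRoadWitness D g₀ os ι Λ Ω Ω' d N)) :
    T4ContinuumYM4Torus.ForSmallCouplings D fun g₀ => T4ApexHybrid.StringwiseHybridNE7 (D.scheme g₀) :=
  hData.mono fun _ h => stringwise_of_chessboardRoad h

/-- **ROW NE7b, ROAD W-RP, AT THE APEX: `HybridNE7Under D (BetaPertHyp D.βfun)` FROM THE PREFIXED WITNESS HYPOTHESIS** —
the apex lineage's input for ALL FOUR T⁴ targets (`T4ApexHybrid.targets_of_hybridNE7Under`).  By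
`T4ContinuumYM4Torus.underHypotheses_iff` it reads `(B) → BetaPertHyp → ForSmallCouplings D (StringwiseHybridNE7 ∘ D.scheme)`;
the two antecedents are ACCEPTED AND NOT USED (`forSmallCouplings_stringwise_of_chessboardRoad` is pin-free;
`T4ContinuumYM4Torus.ForSmallCouplings.underHypotheses` BY NAME) — on road W
the pins enter only at `T4ContinuumYM4Torus.continuumYM4Torus_of_targets` (file 3).  Honest reading: the four T⁴ targets
⇐ [∀ small-coupling tuned run ∀ string, a chessboard-road witness] — the located new estimates NE7b (here: the 21 clauses of
`CutoffReading` per run and cutoff, i.e. (EXT)∕(LOC)∕(R-sym)∕(RP-ext)∕(U1)+(G2) for the printed centred prescription, with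
(B)'s content inside `univ_le` as a READING), NE7c, NE7 (and through its budget NE1′–NE5, NE9) sit INSIDE the witness as
hypothesis shapes, none in print, none a theorem of the tree.  NE7b NOT proved. [folklore] -/
theorem hybridNE7Under_of_chessboardRoad_fsc (D : FiniteEpsData F G)
    (hData : T4ContinuumYM4Torus.ForSmallCouplings D fun g₀ => ∀ os : List (ULoop F),
      ∃ (ι Λ : Type) (_ : DecidableEq ι) (Ω Ω' : ℕ → Type) (_ : ∀ K, MeasurableSpace (Ω K))
        (_ : ∀ K, MeasurableSpace (Ω' K)) (d N : ℕ) (_ : NeZero N),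
        Nonempty (ChessboardRoadWitness D g₀ os ι Λ Ω Ω' d N)) :
    T4ApexHybrid.HybridNE7Under D (BetaPertHyp D.βfun) :=
  (forSmallCouplings_stringwise_of_chessboardRoad D hData).underHypotheses _

/-- **The every-`γ, g > 0` form** (a witness for EVERY positive-coupling tuned run and every string; thresholds `1, 1`):
corollary of `hybridNE7Under_of_chessboardRoad_fsc`.  CONDITIONAL; NE7b NOT proved. [folklore] -/
theorem hybridNE7Under_of_chessboardRoad (D : FiniteEpsData F G)
    (hData : ∀ (γ g : ℝ) (g₀ : ℕ → ℝ), 0 < γ → 0 < g → D.Tuned γ g g₀ → ∀ os : List (ULoop F),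
      ∃ (ι Λ : Type) (_ : DecidableEq ι) (Ω Ω' : ℕ → Type) (_ : ∀ K, MeasurableSpace (Ω K))
        (_ : ∀ K, MeasurableSpace (Ω' K)) (d N : ℕ) (_ : NeZero N),
        Nonempty (ChessboardRoadWitness D g₀ os ι Λ Ω Ω' d N)) :
    T4ApexHybrid.HybridNE7Under D (BetaPertHyp D.βfun) :=
  hybridNE7Under_of_chessboardRoad_fsc D
    ⟨1, one_pos, fun γ hγ _ => ⟨1, one_pos, fun g hg _ g₀ ht => hData γ g g₀ hγ hg ht⟩⟩

end Under

end

end Summit.QuantumFields.BalabanUV.T4Continuum.HistoryChessboardApex
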